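import Mathlib
import HarnessLib
import Summits.CriticalPhenomena.SAWScalingLimit.Theorems.SAWSpinMonotoneQCIdentificationDefs
import Summits.CriticalPhenomena.SAWScalingLimit.Theorems.SAWSpinMonotoneQCIdentificationBoundaryPhaseLaw
import Summits.CriticalPhenomena.SAWScalingLimit.Theorems.SAWSpinMonotoneQCIdentificationStepLawWalks
import Literature.Probability.RandomPlanarGeometry.HexSAWPathRigidity

/-!
# Boundary polar form of the observable (line `eight_fifths_primitive`, stub `stub_noBranching`, S5)

Helper sub-goal S5 of the registered stub `stub_noBranching : NoFoldBound → NoBranching` of the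
checked skeleton `Cruxes/QCIdentification/Lines/eight_fifths_primitive.lean` (item
stmt-CriticalPhenomena-16772); vocabulary of `Theorems/SAWSpinMonotoneQCIdentificationDefs.lean`
(`Fobs`), walks from vertex paths from `Theorems/SAWSpinMonotoneQCIdentificationStepLawWalks.lean`
(`StepLaw.sl_exists_saw_of_path`), rigidity of the boundary winding from
`Literature/…/HexSAWPathRigidity.lean` (`HexMidEdgeSAW.winding_eq_of_mem_boundary`).

**What.** For the critical spin-`5/8` observable `F = Fobs Λ a` of a simply connected domain `Λ`
with boundary source `a = {u_a, v_a}` (`v_a ∈ Λ`, `u_a ∉ Λ`) and a boundary mid-edge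
`p = {u, v}` (`v ∈ Λ`, `u ∉ Λ`):

* `genFun Λ a p = Z_p = Σ_{η : a → p} x_c^{ℓ(η)} ≥ 0`, the positive generating function of the
  walks (`s5_genFun_pos`: `Z_p > 0` as soon as one walk exists);
* **polar form** `F(p) = Z_p · e^{iθ}`, `θ = -(5/8) W_γ` for ANY walk `γ : a → p`
  (`fobs_polar_of_mem_boundary`, registered ∀-form `s5_fobs_boundary_polar`; the phase is spelled
  `Complex.exp (↑(-(5/8) * γ.winding) * Complex.I)`, the `exp (θ I)` normal form of
  `Complex.norm_exp_ofReal_mul_I` / `Complex.arg_exp_mul_I`), hence `‖F(p)‖ = Z_p`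
  (`s5_norm_fobs_boundary`);
* **dart phase** `arg((m_p - c_v) F(p)) ≡ arg(c_u - c_v) - (5/8) W_γ (mod 2π)` as an equality
  in `Real.Angle` (`s5_dart_phase`; `m_p - c_v = ½ (c_u - c_v)`);
* **walks exist on the source component**: if `v` is joined to `v_a` inside `Λ` then there is a
  walk `a → p` (`s5_exists_saw_of_reachable`: a path of the induced graph `ℍ[Λ]` plus the exit
  half-edge, `StepLaw.sl_exists_saw_of_path`), and conversely every walk joins its vertices to
  `v_a` inside `Λ` (`reachable_of_saw`, `reachable_of_saw_boundary`).

Proof of the polar form: all walks `a → p` share the winding `W` of `γ` (rigidity), so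
`F(p) = Σ_η e^{-i(5/8)W} x_c^{ℓ(η)} = e^{-i(5/8)W} Z_p` — the structure of the landed proof of
`stub_boundaryPhaseLaw`, here exported with the amplitude named.

Source: H. Duminil-Copin, S. Smirnov, Ann. of Math. 175 (2012) 1653–1665 (arXiv:1007.0575),
Definition 1 and §3, proof of Lemma 2 (boundary windings evaluated by their common value).
-/

noncomputable section

open scoped BigOperators
open Literature.Probability.LatticeModels Literature.Probability.RandomPlanarGeometry
open Literature.Probability.RandomPlanarGeometry.SAW
open Literature.Barriers.CriticalPhenomena
open Summit.CriticalPhenomena.SAWScalingLimit.Theses.SAWDevelopingMap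

namespace Summit.CriticalPhenomena.SAWScalingLimit.Cruxes.QCIdentification.EightFifthsPrimitive

namespace NB

/-! ### The generating function of the walks -/

/-- The **generating function** `Z_p = Σ_{η : a → p} x_c^{ℓ(η)}` of the self-avoiding walks of
`Λ` from `a` to `p` at the critical fugacity (the observable without its winding phases). -/
def genFun (Λ : Finset HexVertex) (a p : Sym2 HexVertex) : ℝ :=
  ∑ η : HexMidEdgeSAW Λ a p, hexCriticalFugacity ^ η.length

/-- `Z_p ≥ 0`. [folklore] -/
theorem genFun_nonneg (Λ : Finset HexVertex) (a p : Sym2 HexVertex) : 0 ≤ genFun Λ a p :=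
  Finset.sum_nonneg fun _ _ => pow_nonneg hexCriticalFugacity_pos_lt_one.1.le _

/-- **`Z_p > 0` as soon as one walk `a → p` exists** (registered helper `s5_genFun_pos`).
[folklore] -/
theorem s5_genFun_pos : ∀ (Λ : Finset HexVertex) (a p : Sym2 HexVertex), Nonempty (HexMidEdgeSAW Λ a p) → 0 < genFun Λ a p := by
  intro Λ a p hN
  haveI := hN
  exact Finset.sum_pos (fun η _ => pow_pos hexCriticalFugacity_pos_lt_one.1 _) Finset.univ_nonempty

/-- Without walks `Z_p = 0`. [folklore] -/
theorem genFun_eq_zero_of_isEmpty {Λ : Finset HexVertex} {a p : Sym2 HexVertex}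
    (h : IsEmpty (HexMidEdgeSAW Λ a p)) : genFun Λ a p = 0 := by
  simp [genFun]

/-- Without walks `F(p) = 0`. [folklore] -/
theorem fobs_eq_zero_of_isEmpty {Λ : Finset HexVertex} {a p : Sym2 HexVertex}
    (h : IsEmpty (HexMidEdgeSAW Λ a p)) : Fobs Λ a p = 0 := by
  simp [Fobs, hexParafermionicObservable]

/-- The norm of `Z · e^{iθ}` is `Z`. [folklore] -/
theorem norm_genFun_mul_exp (Λ : Finset HexVertex) (a p : Sym2 HexVertex) (θ : ℝ) :
    ‖(genFun Λ a p : ℂ) * Complex.exp (θ * Complex.I)‖ = genFun Λ a p := by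
  rw [norm_mul, Complex.norm_exp_ofReal_mul_I, mul_one, Complex.norm_real,
    Real.norm_of_nonneg (genFun_nonneg Λ a p)]

/-! ### The polar form -/

/-- **Polar form from a common winding.** If every walk `a → p` has winding `W`, then
`F(p) = Z_p · e^{-i(5/8)W}`. [cite: DuminilCopinSmirnov2012, Def. 1] -/
theorem fobs_eq_genFun_mul_exp_of_winding_eq {Λ : Finset HexVertex} {a p : Sym2 HexVertex}
    (W : ℝ) (hW : ∀ η : HexMidEdgeSAW Λ a p, η.winding = W) :
    Fobs Λ a p = (genFun Λ a p : ℂ) * Complex.exp (((-(5 / 8 : ℝ) * W : ℝ) : ℂ) * Complex.I) := by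
  have hexp : Complex.exp (-Complex.I * ((5 / 8 : ℝ) : ℂ) * (W : ℂ)) =
      Complex.exp (((-(5 / 8 : ℝ) * W : ℝ) : ℂ) * Complex.I) := by
    congr 1
    push_cast
    ring
  simp only [Fobs, hexParafermionicObservable, HexMidEdgeSAW.weight, genFun]
  rw [Complex.ofReal_sum, Finset.sum_mul]
  refine Finset.sum_congr rfl fun η _ => ?_
  rw [hW η, hexp, Complex.ofReal_pow, mul_comm]

/-- **Polar form of the observable at a boundary mid-edge.** For `Λ` simply connected and
boundary mid-edges `a`, `b`, every walk `γ : a → b` gives `F(b) = Z_b · e^{-i(5/8)W_γ}`: all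
walks `a → b` have the winding of `γ` (`HexMidEdgeSAW.winding_eq_of_mem_boundary`).
[cite: DuminilCopinSmirnov2012, §3 proof of Lemma 2] -/
theorem fobs_polar_of_mem_boundary {Λ : Finset HexVertex} (hΛ : hexDomainSimplyConnected Λ)
    {a b : Sym2 HexVertex} (ha : a ∈ hexDomainBoundary Λ) (hb : b ∈ hexDomainBoundary Λ)
    (γ : HexMidEdgeSAW Λ a b) :
    Fobs Λ a b = (genFun Λ a b : ℂ) * Complex.exp (((-(5 / 8 : ℝ) * γ.winding : ℝ) : ℂ) * Complex.I) :=
  fobs_eq_genFun_mul_exp_of_winding_eq γ.winding fun η =>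
    HexMidEdgeSAW.winding_eq_of_mem_boundary hΛ ha hb η γ

/-- The norm of the observable at a boundary mid-edge is the generating function:
`‖F(b)‖ = Z_b`. [cite: DuminilCopinSmirnov2012, §3 proof of Lemma 2] -/
theorem norm_fobs_of_mem_boundary {Λ : Finset HexVertex} (hΛ : hexDomainSimplyConnected Λ)
    {a b : Sym2 HexVertex} (ha : a ∈ hexDomainBoundary Λ) (hb : b ∈ hexDomainBoundary Λ) :
    ‖Fobs Λ a b‖ = genFun Λ a b := by
  rcases isEmpty_or_nonempty (HexMidEdgeSAW Λ a b) with hE | ⟨⟨γ⟩⟩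
  · rw [fobs_eq_zero_of_isEmpty hE, genFun_eq_zero_of_isEmpty hE, norm_zero]
  · rw [fobs_polar_of_mem_boundary hΛ ha hb γ, norm_genFun_mul_exp]

/-- The source `a = {u_a, v_a}` (`v_a ∈ Λ ∌ u_a`, adjacent) is a boundary mid-edge. [folklore] -/
theorem mk_mem_boundary {Λ : Finset HexVertex} {u v : HexVertex} (hv : v ∈ Λ) (hu : u ∉ Λ)
    (hvu : hexGraph.Adj v u) : s(u, v) ∈ hexDomainBoundary Λ :=
  ⟨(SimpleGraph.mem_edgeSet hexGraph).2 hvu.symm, u, v, rfl, hv, hu⟩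

/-- **S5, boundary polar form (registered helper `s5_fobs_boundary_polar`).** For `Λ` simply
connected, a boundary source `a = {u_a, v_a}` (`v_a ∈ Λ`, `u_a ∉ Λ`, adjacent), another
boundary mid-edge `p = {u, v}` (`v ∈ Λ`, `u ∉ Λ`, adjacent) and any walk `γ : a → p`:
`F(p) = Z_p · exp(θ i)` with `θ = -(5/8) W_γ` and `Z_p = genFun Λ a p` (`> 0`, `s5_genFun_pos`).
[cite: DuminilCopinSmirnov2012, §3 proof of Lemma 2] -/
theorem s5_fobs_boundary_polar : ∀ (Λ : Finset HexVertex), hexDomainSimplyConnected Λ → ∀ (ua va u v : HexVertex), va ∈ Λ → ua ∉ Λ → hexGraph.Adj va ua → v ∈ Λ → u ∉ Λ → hexGraph.Adj v u → s(u, v) ≠ s(ua, va) → ∀ γ : HexMidEdgeSAW Λ s(ua, va) s(u, v), Fobs Λ s(ua, va) s(u, v) = (genFun Λ s(ua, va) s(u, v) : ℂ) * Complex.exp (((-(5 / 8 : ℝ) * γ.winding : ℝ) : ℂ) * Complex.I) :=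
  fun _ hΛ _ _ _ _ hva hua hadj hv hu hvu _ γ =>
    fobs_polar_of_mem_boundary hΛ (mk_mem_boundary hva hua hadj) (mk_mem_boundary hv hu hvu) γ

/-- **S5, the norm (registered form of `‖F(p)‖ = Z_p`).** Under the hypotheses of
`s5_fobs_boundary_polar` (no walk needed: without walks both sides vanish),
`‖F(p)‖ = genFun Λ a p`. [cite: DuminilCopinSmirnov2012, §3 proof of Lemma 2] -/
theorem s5_norm_fobs_boundary : ∀ (Λ : Finset HexVertex), hexDomainSimplyConnected Λ → ∀ (ua va u v : HexVertex), va ∈ Λ → ua ∉ Λ → hexGraph.Adj va ua → v ∈ Λ → u ∉ Λ → hexGraph.Adj v u → s(u, v) ≠ s(ua, va) → ‖Fobs Λ s(ua, va) s(u, v)‖ = genFun Λ s(ua, va) s(u, v) :=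
  fun _ hΛ _ _ _ _ hva hua hadj hv hu hvu _ =>
    norm_fobs_of_mem_boundary hΛ (mk_mem_boundary hva hua hadj) (mk_mem_boundary hv hu hvu)

/-! ### The dart phase -/

/-- The exit half-edge vector: `m_{uv} - c_v = ½ (c_u - c_v)`. [folklore] -/
theorem hexMidpoint_sub_hexCenter_right (u v : HexVertex) :
    hexMidpoint s(u, v) - hexCenter v = (1 / 2 : ℂ) * (hexCenter u - hexCenter v) := by
  rw [hexMidpoint_mk]
  ring

/-- **S5, dart phase (registered helper `s5_dart_phase`).** Under the hypotheses of
`s5_fobs_boundary_polar`, for any walk `γ : a → p = {u, v}` the boundary dart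
`g = (m_p - c_v) F(p)` has argument `arg g ≡ arg(c_u - c_v) - (5/8) W_γ (mod 2π)`, an
equality in `Real.Angle` (`m_p - c_v = ½(c_u - c_v)`, `F(p) = Z_p e^{-i(5/8)W_γ}`, `Z_p > 0`).
[cite: DuminilCopinSmirnov2012, §3 proof of Lemma 2] -/
theorem s5_dart_phase : ∀ (Λ : Finset HexVertex), hexDomainSimplyConnected Λ → ∀ (ua va u v : HexVertex), va ∈ Λ → ua ∉ Λ → hexGraph.Adj va ua → v ∈ Λ → u ∉ Λ → hexGraph.Adj v u → s(u, v) ≠ s(ua, va) → ∀ γ : HexMidEdgeSAW Λ s(ua, va) s(u, v), (Complex.arg ((hexMidpoint s(u, v) - hexCenter v) * Fobs Λ s(ua, va) s(u, v)) : Real.Angle) = (Complex.arg (hexCenter u - hexCenter v) : Real.Angle) - (((5 / 8 : ℝ) * γ.winding : ℝ) : Real.Angle) := by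
  intro Λ hΛ ua va u v hva hua hadj hv hu hvu hne γ
  rw [s5_fobs_boundary_polar Λ hΛ ua va u v hva hua hadj hv hu hvu hne γ]
  have hZ : 0 < genFun Λ s(ua, va) s(u, v) := s5_genFun_pos _ _ _ ⟨γ⟩
  have hcv : hexCenter u - hexCenter v ≠ 0 := sub_ne_zero.2 (hexCenter_ne_of_adj hvu.symm)
  have key : (hexMidpoint s(u, v) - hexCenter v) *
      ((genFun Λ s(ua, va) s(u, v) : ℂ) *
        Complex.exp (((-(5 / 8 : ℝ) * γ.winding : ℝ) : ℂ) * Complex.I)) =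
      ((genFun Λ s(ua, va) s(u, v) / 2 : ℝ) : ℂ) * ((hexCenter u - hexCenter v) *
        Complex.exp (((-(5 / 8 : ℝ) * γ.winding : ℝ) : ℂ) * Complex.I)) := by
    rw [hexMidpoint_sub_hexCenter_right]
    push_cast
    ring
  rw [key, Complex.arg_real_mul _ (div_pos hZ two_pos),
    Complex.arg_mul_coe_angle hcv (Complex.exp_ne_zero _), HV.arg_exp_mul_I_coe, neg_mul,
    Real.Angle.coe_neg, ← sub_eq_add_neg]

/-- **Dart phase, inside-first orientation** (the shape of the darts
`(m_{vw} - c_v) F{v, w}` of the corner bookkeeping, `w = u ∉ Λ`): the same law with the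
mid-edge written `{v, u}`. [cite: DuminilCopinSmirnov2012, §3 proof of Lemma 2] -/
theorem dart_phase_inside {Λ : Finset HexVertex} (hΛ : hexDomainSimplyConnected Λ)
    {ua va u v : HexVertex} (hva : va ∈ Λ) (hua : ua ∉ Λ) (hadj : hexGraph.Adj va ua) (hv : v ∈ Λ)
    (hu : u ∉ Λ) (hvu : hexGraph.Adj v u) (hne : s(u, v) ≠ s(ua, va))
    (γ : HexMidEdgeSAW Λ s(ua, va) s(u, v)) :
    (Complex.arg ((hexMidpoint s(v, u) - hexCenter v) * Fobs Λ s(ua, va) s(v, u)) : Real.Angle) =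
      (Complex.arg (hexCenter u - hexCenter v) : Real.Angle) -
        (((5 / 8 : ℝ) * γ.winding : ℝ) : Real.Angle) := by
  have e : s(v, u) = s(u, v) := Sym2.eq_swap
  rw [e]
  exact s5_dart_phase Λ hΛ ua va u v hva hua hadj hv hu hvu hne γ

/-! ### Walks and the source component -/

/-- **A chain of `Λ` joins its vertices inside `Λ`**: every vertex of a chain `w :: L` of
adjacent vertices of `Λ` is reachable from `w` in the induced graph `ℍ[Λ]`. [folklore] -/
theorem reachable_of_isChain {Λ : Finset HexVertex} : ∀ (w : HexVertex) (L : List HexVertex), (w :: L).IsChain hexGraph.Adj → ∀ (hΛ : ∀ y ∈ w :: L, y ∈ Λ) (y : HexVertex) (hy : y ∈ w :: L), (hexGraph.induce (Λ : Set HexVertex)).Reachable ⟨w, hΛ w List.mem_cons_self⟩ ⟨y, hΛ y hy⟩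
  | w, [], _, hΛ, y, hy => by
    obtain rfl : y = w := by simpa using hy
    exact SimpleGraph.Reachable.refl _
  | w, w' :: L, hc, hΛ, y, hy => by
    rcases List.mem_cons.1 hy with rfl | hy'
    · exact SimpleGraph.Reachable.refl _
    · obtain ⟨hadj, hc'⟩ := List.isChain_cons_cons.1 hc
      have ih := reachable_of_isChain w' L hc' (fun z hz => hΛ z (List.mem_cons_of_mem _ hz)) y hy'
      refine SimpleGraph.Reachable.trans (SimpleGraph.Adj.reachable ?_) ih
      exact SimpleGraph.induce_adj.2 hadj

/-- **A walk from the boundary source joins its vertices to `v_a` inside `Λ`**: for a walk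
`γ` from `a = {u_a, v_a}` (`u_a ∉ Λ`), every visited vertex is reachable from `v_a` in the
induced graph `ℍ[Λ]` (the walk starts at `v_a` and is a chain of `Λ`). [folklore] -/
theorem reachable_of_saw {Λ : Finset HexVertex} {ua va : HexVertex} {z : Sym2 HexVertex}
    (hua : ua ∉ Λ) (hva : va ∈ Λ) (γ : HexMidEdgeSAW Λ s(ua, va) z) (hne : γ.verts ≠ [])
    {w : HexVertex} (hw : w ∈ γ.verts) (hwΛ : w ∈ Λ) :
    (hexGraph.induce (Λ : Set HexVertex)).Reachable ⟨va, hva⟩ ⟨w, hwΛ⟩ := by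
  obtain ⟨w₀, L, hL⟩ := List.exists_cons_of_ne_nil hne
  have hhead := γ.head_eq rfl hua hne
  have h0 : w₀ = va := by rw [← hhead]; simp [hL]
  rw [h0] at hL
  have hc : (va :: L).IsChain hexGraph.Adj := hL ▸ γ.isChain
  have hΛ : ∀ y ∈ va :: L, y ∈ Λ := fun y hy => γ.subset y (hL ▸ hy)
  exact reachable_of_isChain va L hc hΛ w (hL ▸ hw)

/-- **A walk between boundary mid-edges joins the inner endpoints inside `Λ`**: a walk
`γ : a = {u_a, v_a} → p = {u, v}` (`u_a, u ∉ Λ`, `p ≠ a`) ends at `v`, so `v` is reachable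
from `v_a` in `ℍ[Λ]`. [folklore] -/
theorem reachable_of_saw_boundary {Λ : Finset HexVertex} {ua va u v : HexVertex} (hua : ua ∉ Λ)
    (hva : va ∈ Λ) (hu : u ∉ Λ) (hv : v ∈ Λ) (hne : s(u, v) ≠ s(ua, va))
    (γ : HexMidEdgeSAW Λ s(ua, va) s(u, v)) :
    (hexGraph.induce (Λ : Set HexVertex)).Reachable ⟨va, hva⟩ ⟨v, hv⟩ := by
  have hne' : γ.verts ≠ [] := fun h => hne (γ.eq_of_nil h).symm
  have hlast : γ.verts.getLast hne' = v := by
    rcases γ.getLast_eq_or hne' with h | h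
    · exact absurd (h ▸ γ.subset _ (List.getLast_mem hne')) hu
    · exact h
  have hvmem : γ.verts.getLast hne' ∈ γ.verts := List.getLast_mem hne'
  rw [hlast] at hvmem
  exact reachable_of_saw hua hva γ hne' hvmem hv

/-- **S5, walks exist on the source component (registered helper
`s5_exists_saw_of_reachable`).** For a boundary source `a = {u_a, v_a}` (`v_a ∈ Λ`, `u_a ∉ Λ`,
adjacent) and a boundary mid-edge `p = {u, v} ≠ a` (`v ∈ Λ`, `u ∉ Λ`, adjacent) whose inner
endpoint `v` is joined to `v_a` inside `Λ`, there is a self-avoiding walk `a → p`: a path of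
`ℍ[Λ]` from `v_a` to `v` closed by the exit half-edge towards `u`
(`StepLaw.sl_exists_saw_of_path`). [folklore] -/
theorem s5_exists_saw_of_reachable : ∀ (Λ : Finset HexVertex) (ua va u v : HexVertex) (hva : va ∈ Λ), ua ∉ Λ → hexGraph.Adj va ua → ∀ (hv : v ∈ Λ), u ∉ Λ → hexGraph.Adj v u → s(u, v) ≠ s(ua, va) → (hexGraph.induce (Λ : Set HexVertex)).Reachable ⟨va, hva⟩ ⟨v, hv⟩ → Nonempty (HexMidEdgeSAW Λ s(ua, va) s(u, v)) := by
  intro Λ ua va u v hva hua hadj hv hu hvu hne hreach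
  obtain ⟨p⟩ := hreach
  have ha : s(ua, va) ∈ hexDomainMidEdges Λ :=
    hexDomainBoundary_subset Λ (mk_mem_boundary hva hua hadj)
  -- a path of the induced graph, read as a list of vertices of `Λ`
  set q := p.bypass with hq
  have hpath : q.IsPath := p.bypass_isPath
  set L : List HexVertex := q.support.map Subtype.val with hLdef
  have hL : L ≠ [] := by simp [hLdef]
  have hchain : L.IsChain hexGraph.Adj :=
    List.isChain_map_of_isChain Subtype.val (fun _ _ h => SimpleGraph.induce_adj.1 h)
      q.isChain_adj_support
  have hnodup : L.Nodup := hpath.support_nodup.map Subtype.val_injective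
  have hsub : ∀ y ∈ L, y ∈ Λ := by
    intro y hy
    obtain ⟨w, -, rfl⟩ := List.mem_map.1 hy
    exact w.2
  have hhead : L.head hL = va := by simp [hLdef]
  have hlast : L.getLast hL = v := by simp [hLdef]
  obtain ⟨η, -, -⟩ := StepLaw.sl_exists_saw_of_path Λ ua va hua ha L hL hchain hnodup hsub hhead
    u v hu hlast hne
  exact ⟨η⟩

end NB

end Summit.CriticalPhenomena.SAWScalingLimit.Cruxes.QCIdentification.EightFifthsPrimitive

end
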